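import Summits.RiemannHypothesis.RiemannHypothesis.Theorems.Splittings.LiOneSidedCriteriaCesaro
import Summits.RiemannHypothesis.RiemannHypothesis.Theorems.Splittings.LiDescentCountingLawRH
import HarnessLib

/-!
# MONOTONICITY SCALES for the Keiper–Li coefficients (which monotonicities are RH, and at what scale) — SketchG12 §§1–4

Cell rh-split, seat rh-split-li-bridge g12 (brief sha16 f79c5f09d8bcb036), card `run/shared/lean/pub/rh-split/cards/SPLIT-li-bridge.md`
§19; kernel source `HOME/rh-split-li-bridge/SketchG12.lean` sha16 9a9c06b3580ba945 (414 l, farm rc 0 · 0 err · 0 warn · 0 sorry, std axioms),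
cut by the seat as ONE file (11 theorems), decl text byte-verbatim; deltas = namespace `RhSplit.LiBridgeG12` ↦ `…Splittings.LiMonotonicityScales`,
this docstring, `set_option linter.dupNamespace false`.  Tree inputs only (cited, not re-derived): `Voros2006_thm_onlyif_holds` (Oesterlé–Voros
`λ_n = ½n(log n − 1 + γ − log 2π) + o(n)` under RH), `riemannHypothesis_of_keiperLiCoeff_bddBelow` (Bombieri–Lagarias), `LiOneSidedCriteria.
rh_of_liCesaroFloor`, `LiDescentCountingLaw.blockLaw_sharp_of_rh` + `LiIncrMeanSquare.sum_sq_le'`.  Standard axioms.  Zero definitions.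

WHAT IS PROVED (`λ_n = keiperLiCoeff n`, `M_N = (Σ_{n≤N} λ_n)/N`).  §1 `li_voros_envelope_of_rh` (input shape).  §2 DILATION, scale `k = εn`:
`li_dilationMonotone_of_rh : RH → ∀ ε > 0, ∃ m₀, ∀ m ≥ m₀, ∀ n ≥ (1+ε)m, λ_m < λ_n`; `rh_of_li_dilationMonotone` (any factor `c`; RH-free:
bounded below ⟹ B–L); RH-EQUIVALENCES `rh_iff_li_dilationMonotone` (each fixed ε), `rh_iff_li_dilationMonotone_some`.  §3 CESÀRO MEANS:
`liPartialSum_le_mul_succ_of_rh : RH → Σ_{n≤N} λ_n ≤ N·λ_{N+1}` eventually; RH-EQUIVALENCE `rh_iff_liCesaroMean_eventually_monotone :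
RH ↔ ∃ N₀, ∀ N ≥ N₀, M_N ≤ M_{N+1}` (← : linear Cesàro floor + `rh_of_liCesaroFloor`).  §4 WINDOW, scale `k = N/log²N`:
`li_windowMonotone_of_rh : RH → ∃ C ≥ 0, ∃ N₀, ∀ N ≥ N₀, ∀ n k, N ≤ n → n+k ≤ 2N → C·N/log²N < k → λ_n < λ_{n+k}` (sharp block law +
Cauchy–Schwarz); `rh_of_li_windowMonotone` (any `C`; strong induction `λ_M > λ_{⌈M/2⌉}`); RH-EQUIVALENCE `rh_iff_li_windowMonotone`.
PORTRAIT: along `k = εn ⟶ N/log²N ⟶ 1`, «`λ_n < λ_{n+k}` on scale-`k` windows» is an RH-EQUIVALENCE in kernel down to `N/log²N`, while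
«RH ⟹ it» is OPEN only at `k = 1` (the in-print «λ_n increasing» conjecture, card K7; `CostumeDetectors.rh_of_keiperLiCoeff_eventually_monotone`
is the other direction); the Cesàro-averaged step-1 statement is again an RH-EQUIVALENCE.  In print: NULL (corpus fts + vec, galaxy; card §19.4).

HONEST LABEL: «SPLITTING SEARCH over kernel-typed RH-EQUIVALENCES; a splitting A ∧ B ⟹ RH is CONDITIONAL bookkeeping unless A and B are
both proved; nothing here bears on the truth of RH.»  Every theorem below is an RH-CONSEQUENCE (`RiemannHypothesis → …`), an RH-FREE
implication (`… → RiemannHypothesis`), or an RH-EQUIVALENCE labelled RELABELLING (neither side asserted); none is a claim about RH.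
-/

set_option linter.dupNamespace false

noncomputable section

namespace Summit.RiemannHypothesis.RiemannHypothesis.Theorems.Splittings.LiMonotonicityScales

open Filter Topology Finset Asymptotics
open scoped Real
open Literature.NumberTheory.LFunctions
open Summit.RiemannHypothesis.RiemannHypothesis.Theorems.Splittings
open Summit.RiemannHypothesis.RiemannHypothesis.Theorems.Splittings.LiOneSidedCriteria
open Summit.RiemannHypothesis.RiemannHypothesis.Theorems.Splittings.LiIncrMeanSquare.MeanSquare
open Summit.RiemannHypothesis.RiemannHypothesis.Theorems.Splittings.LiDescentCountingLaw (blockLaw_sharp_of_rh)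

/-! ## §1 Input shape: the Oesterlé–Voros envelope under RH -/

/-- **RH-CONSEQUENCE (input shape).** For every `δ > 0`, beyond a threshold: `|λ_n − (n/2)·L(n)| ≤ δ·n` and `2 ≤ L(n)`,
where `L(n) = log n − 1 + γ − log 2π` (tree `Voros2006_thm_onlyif_holds`; the bound `2 ≤ L(n)` for `n ≥ 2¹⁴` exactly as in
`LiTuranLawRH.li_linear_bounds_of_rh`). -/
theorem li_voros_envelope_of_rh (hRH : _root_.RiemannHypothesis) {δ : ℝ} (hδ : 0 < δ) :
    ∃ N₁ : ℕ, ∀ n : ℕ, N₁ ≤ n →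
      |keiperLiCoeff n -
          (n : ℝ) / 2 * (Real.log n - 1 + Real.eulerMascheroniConstant - Real.log (2 * Real.pi))| ≤ δ * n ∧
        2 ≤ Real.log n - 1 + Real.eulerMascheroniConstant - Real.log (2 * Real.pi) := by
  have hV := (Voros2006_thm_onlyif_holds hRH).def hδ
  obtain ⟨N, hN⟩ := eventually_atTop.1 (hV.and (eventually_ge_atTop (2 ^ 14)))
  refine ⟨N, fun n hn ↦ ?_⟩
  obtain ⟨hb, hn14⟩ := hN n hn
  have hn14' : (2 : ℝ) ^ 14 ≤ n := by exact_mod_cast hn14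
  have hlog2 : (0.6931471803 : ℝ) < Real.log 2 := Real.log_two_gt_d9
  have hlogn : Real.log ((2 : ℝ) ^ 14) ≤ Real.log n := Real.log_le_log (by positivity) hn14'
  rw [Real.log_pow] at hlogn
  push_cast at hlogn
  have hγ : (1 : ℝ) / 2 < Real.eulerMascheroniConstant := Real.one_half_lt_eulerMascheroniConstant
  have hlog2π : Real.log (2 * Real.pi) ≤ 2 * Real.pi - 1 := Real.log_le_sub_one_of_pos (by positivity)
  have hπ : Real.pi ≤ 4 := Real.pi_le_four
  rw [Real.norm_eq_abs, Real.norm_eq_abs, Nat.abs_cast] at hb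
  exact ⟨hb, by linarith⟩

/-! ## §2 Dilation monotonicity `λ_m < λ_n` for `n ≥ (1+ε) m` -/

/-- **RH-CONSEQUENCE: (1+ε)-DILATION MONOTONICITY.**  Under RH, for every `ε > 0` there is `m₀` with
`λ_m < λ_n` whenever `m ≥ m₀` and `n ≥ (1+ε)·m`.  Proof: with `δ = ε/(4(1+ε))` in §1,
`λ_n − λ_m ≥ [(n/2)L(n) − (m/2)L(m)] − δ(n+m) ≥ (n − m) − 2δn ≥ 2δn > 0`, using `L(m) ≥ 2`, `L(n) ≥ L(m)`, `n − m ≥ 4δn`. -/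
private theorem li_dilationMonotone_of_rh (hRH : _root_.RiemannHypothesis) {ε : ℝ} (hε : 0 < ε) :
    ∃ m₀ : ℕ, ∀ m : ℕ, m₀ ≤ m → ∀ n : ℕ, (1 + ε) * (m : ℝ) ≤ n → keiperLiCoeff m < keiperLiCoeff n := by
  have hε1 : 0 < 1 + ε := by linarith
  set δ : ℝ := ε / (4 * (1 + ε)) with hδdef
  have hδ : 0 < δ := by positivity
  have hδε : δ * (4 * (1 + ε)) = ε := by rw [hδdef]; field_simp
  obtain ⟨N₁, hN₁⟩ := li_voros_envelope_of_rh hRH hδ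
  refine ⟨max N₁ 1, fun m hm n hmn ↦ ?_⟩
  have hmN : N₁ ≤ m := le_of_max_le_left hm
  have hm1 : 1 ≤ m := le_of_max_le_right hm
  have hm1' : (1 : ℝ) ≤ m := by exact_mod_cast hm1
  have hmn' : (m : ℝ) ≤ n := by nlinarith
  have hmnN : m ≤ n := by exact_mod_cast hmn'
  have hnN : N₁ ≤ n := hmN.trans hmnN
  obtain ⟨hbm, hLm⟩ := hN₁ m hmN
  obtain ⟨hbn, -⟩ := hN₁ n hnN
  have hn0 : (0 : ℝ) < n := by linarith
  have hlogmn : Real.log m ≤ Real.log n := Real.log_le_log (by linarith) hmn'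
  -- the gap: `n − m ≥ 4δn`
  have hgap : 4 * δ * n ≤ (n : ℝ) - m := by
    have h1 : ε * n ≤ ((n : ℝ) - m) * (1 + ε) := by nlinarith
    have h2 : 4 * δ * n * (1 + ε) = ε * n := by
      calc 4 * δ * n * (1 + ε) = δ * (4 * (1 + ε)) * n := by ring
        _ = ε * n := by rw [hδε]
    nlinarith
  obtain ⟨-, hbm2⟩ := abs_le.1 hbm
  obtain ⟨hbn1, -⟩ := abs_le.1 hbn
  -- main-term gap: `(n/2)L(n) − (m/2)L(m) ≥ n − m`
  have hmain : (n : ℝ) - m ≤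
      (n : ℝ) / 2 * (Real.log n - 1 + Real.eulerMascheroniConstant - Real.log (2 * Real.pi)) -
        (m : ℝ) / 2 * (Real.log m - 1 + Real.eulerMascheroniConstant - Real.log (2 * Real.pi)) := by
    nlinarith [mul_nonneg hn0.le (sub_nonneg.2 hlogmn), mul_nonneg (sub_nonneg.2 hmn') (sub_nonneg.2 hLm)]
  have hδmn : δ * m ≤ δ * n := mul_le_mul_of_nonneg_left hmn' hδ.le
  have hδn : 0 < δ * n := mul_pos hδ hn0
  linarith

/-- **RH-FREE: dilation monotonicity for ONE factor ⟹ RH.**  If for some real `c` and threshold `m₀`,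
`λ_m ≤ λ_n` whenever `m ≥ m₀` and `n ≥ c·m`, then the Li sequence is bounded below, hence RH
(Bombieri–Lagarias Thm 1 (c)⇒(a), tree `riemannHypothesis_of_keiperLiCoeff_bddBelow`). [cite: BombieriLagarias1999, Theorem 1] -/
theorem rh_of_li_dilationMonotone {c : ℝ} {m₀ : ℕ}
    (h : ∀ m : ℕ, m₀ ≤ m → ∀ n : ℕ, c * (m : ℝ) ≤ n → keiperLiCoeff m ≤ keiperLiCoeff n) :
    _root_.RiemannHypothesis := by
  obtain ⟨T, hT⟩ := exists_nat_ge (c * (m₀ : ℝ))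
  set H : ℝ := ∑ k ∈ Finset.range T, |keiperLiCoeff k| with hH
  have hH0 : 0 ≤ H := Finset.sum_nonneg fun k _ ↦ abs_nonneg _
  refine riemannHypothesis_of_keiperLiCoeff_bddBelow (K := H + |keiperLiCoeff m₀|) fun n _ ↦ ?_
  by_cases hnT : n < T
  · have hle : |keiperLiCoeff n| ≤ H :=
      Finset.single_le_sum (f := fun k ↦ |keiperLiCoeff k|) (fun k _ ↦ abs_nonneg _) (Finset.mem_range.2 hnT)
    have := neg_abs_le (keiperLiCoeff n)
    linarith [abs_nonneg (keiperLiCoeff m₀)]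
  · have hTn : (T : ℝ) ≤ n := by exact_mod_cast not_lt.1 hnT
    have := h m₀ le_rfl n (hT.trans hTn)
    linarith [neg_abs_le (keiperLiCoeff m₀)]

/-- **RH-EQUIVALENCE (RELABELLING; neither side asserted): RH ⟺ (1+ε)-dilation monotonicity for every `ε > 0`.**
For each FIXED `ε > 0` the displayed property is already equivalent to RH (→ §2; ← `rh_of_li_dilationMonotone` at that ε).
Contrast: the step-1 statement «`λ_n ≤ λ_{n+1}` eventually» (card K7) is the `ε → 0⁺` endpoint, where `RH ⟹` is OPEN. -/
theorem rh_iff_li_dilationMonotone :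
    _root_.RiemannHypothesis ↔
      ∀ ε : ℝ, 0 < ε → ∃ m₀ : ℕ, ∀ m : ℕ, m₀ ≤ m → ∀ n : ℕ, (1 + ε) * (m : ℝ) ≤ n →
        keiperLiCoeff m < keiperLiCoeff n := by
  refine ⟨fun h ε hε ↦ li_dilationMonotone_of_rh h hε, fun h ↦ ?_⟩
  obtain ⟨m₀, hm₀⟩ := h 1 one_pos
  exact rh_of_li_dilationMonotone (c := 1 + 1) (m₀ := m₀) fun m hm n hmn ↦ (hm₀ m hm n hmn).le

/-- **RH-EQUIVALENCE (RELABELLING): RH ⟺ dilation monotonicity for SOME factor `c`** (weak inequality). -/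
theorem rh_iff_li_dilationMonotone_some :
    _root_.RiemannHypothesis ↔
      ∃ c : ℝ, ∃ m₀ : ℕ, ∀ m : ℕ, m₀ ≤ m → ∀ n : ℕ, c * (m : ℝ) ≤ n → keiperLiCoeff m ≤ keiperLiCoeff n := by
  refine ⟨fun h ↦ ?_, fun ⟨c, m₀, h⟩ ↦ rh_of_li_dilationMonotone h⟩
  obtain ⟨m₀, hm₀⟩ := li_dilationMonotone_of_rh h one_pos
  exact ⟨1 + 1, m₀, fun m hm n hmn ↦ (hm₀ m hm n hmn).le⟩

/-! ## §3 Cesàro-mean monotonicity -/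

/-- Gauss: `Σ_{n=1}^{N} n = N(N+1)/2` (cast to `ℝ`). -/
theorem sum_Icc_one_cast (N : ℕ) : ∑ n ∈ Finset.Icc 1 N, (n : ℝ) = (N : ℝ) * (N + 1) / 2 := by
  induction N with
  | zero => simp
  | succ k ih =>
    rw [Finset.sum_Icc_succ_top (by omega), ih]
    push_cast
    ring

/-- **RH-CONSEQUENCE: the mean is overtaken by the next term.**  Under RH there is `N₀` with
`Σ_{n≤N} λ_n ≤ N·λ_{N+1}` for all `N ≥ N₀` (i.e. `M_N ≤ λ_{N+1}`).  Proof: §1 at `δ = 1/8` gives, for `1 ≤ n ≤ N`,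
`λ_n ≤ [n < N₁]|λ_n| + n(L(N)/2 + 1/8)`, so `Σ_{n≤N} λ_n ≤ H + (N(N+1)/2)(L(N)/2 + 1/8)`, while
`N λ_{N+1} ≥ N(N+1)(L(N)/2 − 1/8)`; the difference is `≥ N(N+1)(L/4 − 3/16) − H ≥ (5/16)N − H ≥ 0` once `N ≥ 4H`. -/
theorem liPartialSum_le_mul_succ_of_rh (hRH : _root_.RiemannHypothesis) :
    ∃ N₀ : ℕ, ∀ N : ℕ, N₀ ≤ N → ∑ n ∈ Finset.Icc 1 N, keiperLiCoeff n ≤ N * keiperLiCoeff (N + 1) := by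
  obtain ⟨N₁, hN₁⟩ := li_voros_envelope_of_rh hRH (show (0 : ℝ) < 1 / 8 by norm_num)
  set H : ℝ := ∑ k ∈ Finset.range N₁, |keiperLiCoeff k| with hH
  have hH0 : 0 ≤ H := Finset.sum_nonneg fun k _ ↦ abs_nonneg _
  obtain ⟨T, hT⟩ := exists_nat_ge (4 * H)
  refine ⟨max N₁ (max T 1), fun N hN ↦ ?_⟩
  have hNN₁ : N₁ ≤ N := le_of_max_le_left hN
  have hNT : T ≤ N := le_of_max_le_left (le_of_max_le_right hN)
  have hN1 : 1 ≤ N := le_of_max_le_right (le_of_max_le_right hN)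
  have hN1' : (1 : ℝ) ≤ N := by exact_mod_cast hN1
  have hN0 : (0 : ℝ) < N := by linarith
  have hTN : (T : ℝ) ≤ N := by exact_mod_cast hNT
  have h4H : 4 * H ≤ (N : ℝ) := hT.trans hTN
  obtain ⟨-, hL⟩ := hN₁ N hNN₁
  obtain ⟨hbN1, -⟩ := hN₁ (N + 1) (by omega)
  push_cast at hbN1
  -- pointwise bound on `Icc 1 N`
  have hpt : ∀ n ∈ Finset.Icc 1 N, keiperLiCoeff n ≤
      (if n < N₁ then |keiperLiCoeff n| else 0) +
        (n : ℝ) * ((Real.log N - 1 + Real.eulerMascheroniConstant - Real.log (2 * Real.pi)) / 2 + 1 / 8) := by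
    intro n hn
    obtain ⟨hn1, hnN⟩ := Finset.mem_Icc.1 hn
    have hn1' : (1 : ℝ) ≤ n := by exact_mod_cast hn1
    have hnN' : (n : ℝ) ≤ N := by exact_mod_cast hnN
    have hlognN : Real.log n ≤ Real.log N := Real.log_le_log (by linarith) hnN'
    have hpos : 0 ≤ (n : ℝ) *
        ((Real.log N - 1 + Real.eulerMascheroniConstant - Real.log (2 * Real.pi)) / 2 + 1 / 8) :=
      mul_nonneg (by linarith) (by linarith)
    by_cases h : n < N₁
    · rw [if_pos h]
      linarith [le_abs_self (keiperLiCoeff n)]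
    · rw [if_neg h, zero_add]
      obtain ⟨hb, -⟩ := hN₁ n (not_lt.1 h)
      have h2 := (abs_le.1 hb).2
      have h3 : (n : ℝ) / 2 * (Real.log n - 1 + Real.eulerMascheroniConstant - Real.log (2 * Real.pi)) ≤
          (n : ℝ) / 2 * (Real.log N - 1 + Real.eulerMascheroniConstant - Real.log (2 * Real.pi)) :=
        mul_le_mul_of_nonneg_left (by linarith) (by linarith)
      linarith
  have hsum := Finset.sum_le_sum hpt
  rw [Finset.sum_add_distrib, ← Finset.sum_mul, sum_Icc_one_cast] at hsum
  have hhead : ∑ n ∈ Finset.Icc 1 N, (if n < N₁ then |keiperLiCoeff n| else 0) ≤ H := by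
    rw [← Finset.sum_filter]
    refine Finset.sum_le_sum_of_subset_of_nonneg (fun n hn ↦ ?_) fun n _ _ ↦ abs_nonneg _
    rw [Finset.mem_filter] at hn
    exact Finset.mem_range.2 hn.2
  -- lower bound for the next term: `λ_{N+1} ≥ ((N+1)/2) L(N) − (N+1)/8`
  have hlogNN1 : Real.log N ≤ Real.log ((N : ℝ) + 1) := Real.log_le_log hN0 (by linarith)
  obtain ⟨hb1, -⟩ := abs_le.1 hbN1
  have hnext : ((N : ℝ) + 1) / 2 * (Real.log N - 1 + Real.eulerMascheroniConstant - Real.log (2 * Real.pi)) -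
      1 / 8 * ((N : ℝ) + 1) ≤ keiperLiCoeff (N + 1) := by
    have h3 : ((N : ℝ) + 1) / 2 * (Real.log N - 1 + Real.eulerMascheroniConstant - Real.log (2 * Real.pi)) ≤
        ((N : ℝ) + 1) / 2 * (Real.log ((N : ℝ) + 1) - 1 + Real.eulerMascheroniConstant - Real.log (2 * Real.pi)) :=
      mul_le_mul_of_nonneg_left (by linarith) (by linarith)
    linarith
  have hNnext := mul_le_mul_of_nonneg_left hnext hN0.le
  -- the room: `N(N+1)(L/4 − 3/16) ≥ (5/16)·N(N+1) ≥ (5/16)N ≥ (5/4)H`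
  have hroom : (N : ℝ) * (N + 1) * (5 / 16) ≤
      (N : ℝ) * (N + 1) * ((Real.log N - 1 + Real.eulerMascheroniConstant - Real.log (2 * Real.pi)) / 4 - 3 / 16) :=
    mul_le_mul_of_nonneg_left (by linarith) (by positivity)
  have hNsq : (N : ℝ) ≤ N * (N + 1) := by nlinarith
  linarith

/-- **RH-EQUIVALENCE (RELABELLING; neither side asserted): RH ⟺ the CESÀRO MEANS `M_N = (Σ_{n≤N} λ_n)/N` are
eventually non-decreasing.**  → : §3 (`Σ_{n≤N} λ_n ≤ Nλ_{N+1}` is `M_N ≤ M_{N+1}` after clearing denominators).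
← : a non-decreasing mean from `N₁` on gives the LINEAR floor `Σ_{n≤N} λ_n ≥ μN` (`μ = M_{N₁}`), in particular
`≥ −(|μ|/ε)e^{εN}`, and the tree's `rh_of_liCesaroFloor` (σ = 1; Bombieri–Lagarias via Abel summation) closes.
The AVERAGED form of the in-print monotonicity conjecture K7 is thus RH restated; K7 itself (step 1, pointwise) is not known to follow from RH. -/
theorem rh_iff_liCesaroMean_eventually_monotone :
    _root_.RiemannHypothesis ↔
      ∃ N₀ : ℕ, ∀ N : ℕ, N₀ ≤ N →
        (∑ n ∈ Finset.Icc 1 N, keiperLiCoeff n) / N ≤ (∑ n ∈ Finset.Icc 1 (N + 1), keiperLiCoeff n) / (N + 1) := by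
  constructor
  · intro hRH
    obtain ⟨N₀, hN₀⟩ := liPartialSum_le_mul_succ_of_rh hRH
    refine ⟨max N₀ 1, fun N hN ↦ ?_⟩
    have hN1 : (1 : ℝ) ≤ N := by exact_mod_cast le_of_max_le_right hN
    have hN0 : (0 : ℝ) < N := by linarith
    have h := hN₀ N (le_of_max_le_left hN)
    rw [Finset.sum_Icc_succ_top (by omega), div_le_div_iff₀ hN0 (by linarith)]
    nlinarith
  · rintro ⟨N₀, hN₀⟩
    have hN₁1 : 1 ≤ max N₀ 1 := le_max_right _ _
    -- the mean is non-decreasing from `N₁ = max N₀ 1` on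
    have hmono : ∀ N : ℕ, max N₀ 1 ≤ N →
        (∑ n ∈ Finset.Icc 1 (max N₀ 1), keiperLiCoeff n) / (max N₀ 1 : ℕ) ≤
          (∑ n ∈ Finset.Icc 1 N, keiperLiCoeff n) / N := by
      intro N hN
      induction N with
      | zero =>
        have h0 : max N₀ 1 = 0 := by omega
        omega
      | succ k ih =>
        rcases Nat.lt_or_ge k (max N₀ 1) with hlt | hge
        · have h1 : max N₀ 1 = k + 1 := by omega
          rw [h1]
        · have h2 := hN₀ k ((le_max_left _ _).trans hge)
          have h3 := ih hge
          rw [Nat.cast_succ]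
          exact h3.trans h2
    set μ : ℝ := (∑ n ∈ Finset.Icc 1 (max N₀ 1), keiperLiCoeff n) / (max N₀ 1 : ℕ) with hμ
    refine rh_of_liCesaroFloor (σ := 1) (Or.inl rfl) fun ε hε ↦ ⟨|μ| / ε, max N₀ 1, fun N hN ↦ ?_⟩
    have hN1 : (1 : ℝ) ≤ N := by exact_mod_cast hN₁1.trans hN
    have hN0 : (0 : ℝ) < N := by linarith
    have h1 := hmono N hN
    rw [le_div_iff₀ hN0] at h1
    have h2 : ε * N + 1 ≤ Real.exp (ε * N) := Real.add_one_le_exp _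
    have h3 : -|μ| * N ≤ μ * N := mul_le_mul_of_nonneg_right (neg_abs_le μ) hN0.le
    have h4 : |μ| * N ≤ |μ| / ε * Real.exp (ε * N) := by
      rw [div_mul_eq_mul_div, le_div_iff₀ hε]
      have := mul_le_mul_of_nonneg_left h2 (abs_nonneg μ)
      nlinarith [abs_nonneg μ]
    rw [one_mul]
    linarith

/-! ## §4 Window monotonicity at scale `N / log² N` on dyadic blocks (from the tree's sharp block law) -/

/-- **RH-CONSEQUENCE: WINDOW MONOTONICITY AT SCALE `N / log² N`.**  Under RH there are `C ≥ 0` and `N₀` such that on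
every dyadic block, `N ≥ N₀`: `λ_n < λ_{n+k}` whenever `N ≤ n`, `n + k ≤ 2N` and `k > C·N/(log N)²`.
Proof: `blockLaw_sharp_of_rh` writes `Δ_i = P(i) + F(i)` on `[N,2N)` with `P(i) ≥ (1/10)log N` and `Σ_{[N,2N)} F² ≤ C₀N`
(`sum_sq_le'`), so `λ_{n+k} − λ_n = Σ_{i∈[n,n+k)} Δ_i ≥ (k/10)log N − √(k·C₀N)` (Cauchy–Schwarz) `> 0` once
`k log²N > 100 C₀N`; `C = 100 C₀`. -/
theorem li_windowMonotone_of_rh (hRH : _root_.RiemannHypothesis) :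
    ∃ C : ℝ, 0 ≤ C ∧ ∃ N₀ : ℕ, ∀ N : ℕ, N₀ ≤ N → ∀ n k : ℕ, N ≤ n → n + k ≤ N + N →
      C * N / Real.log N ^ 2 < k → keiperLiCoeff n < keiperLiCoeff (n + k) := by
  obtain ⟨C₀, hC₀, N₀, hblk⟩ := blockLaw_sharp_of_rh hRH
  refine ⟨100 * C₀, by positivity, N₀, fun N hN n k hNn hnk hk ↦ ?_⟩
  obtain ⟨hN2, s, a, θ, P, hθ, hdec, hP, hW⟩ := hblk N hN
  have hN1 : (1 : ℝ) < N := by exact_mod_cast hN2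
  have hlog : 0 < Real.log N := Real.log_pos hN1
  have hN0 : (0 : ℝ) < N := by linarith
  have hk0' : (0 : ℝ) < k := lt_of_le_of_lt (by positivity) hk
  -- the oscillatory part and its block mean square
  set F : ℕ → ℝ := fun i ↦ ∑ j ∈ s, a j * Real.sin (((i : ℝ) + 1 / 2) * θ j) with hF
  have hFsq : ∑ i ∈ Finset.Ico N (N + N), F i ^ 2 ≤ C₀ * N :=
    (sum_sq_le' s a θ hθ N (M := N) (by omega)).trans hW
  have hsub : Finset.Ico n (n + k) ⊆ Finset.Ico N (N + N) := Finset.Ico_subset_Ico hNn hnk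
  -- telescoping over the window
  have htel : keiperLiCoeff (n + k) - keiperLiCoeff n =
      ∑ i ∈ Finset.Ico n (n + k), (keiperLiCoeff (i + 1) - keiperLiCoeff i) := by
    rw [Finset.sum_Ico_eq_sub _ (by omega : n ≤ n + k), Finset.sum_range_sub, Finset.sum_range_sub]
    ring
  have hwin : ∑ i ∈ Finset.Ico n (n + k), (keiperLiCoeff (i + 1) - keiperLiCoeff i) =
      ∑ i ∈ Finset.Ico n (n + k), P i + ∑ i ∈ Finset.Ico n (n + k), F i := by
    rw [← Finset.sum_add_distrib]
    exact Finset.sum_congr rfl fun i hi ↦ hdec i (hsub hi)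
  have hcard : ((Finset.Ico n (n + k)).card : ℝ) = k := by
    rw [Nat.card_Ico, Nat.add_sub_cancel_left]
  -- the trend part: `Σ P ≥ (k/10) log N`
  have hPsum : (k : ℝ) * (1 / 10 * Real.log N) ≤ ∑ i ∈ Finset.Ico n (n + k), P i := by
    have h := Finset.card_nsmul_le_sum (Finset.Ico n (n + k)) P (1 / 10 * Real.log N) fun i hi ↦ hP i (hsub hi)
    rwa [nsmul_eq_mul, hcard] at h
  -- the oscillatory part: `(Σ F)² ≤ k · C₀ N` (Cauchy–Schwarz, window ⊆ block)
  have hCS : (∑ i ∈ Finset.Ico n (n + k), F i) ^ 2 ≤ k * (C₀ * N) := by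
    have h1 := sq_sum_le_card_mul_sum_sq (s := Finset.Ico n (n + k)) (f := F)
    rw [hcard] at h1
    have h2 : ∑ i ∈ Finset.Ico n (n + k), F i ^ 2 ≤ C₀ * N :=
      (Finset.sum_le_sum_of_subset_of_nonneg hsub fun i _ _ ↦ sq_nonneg (F i)).trans hFsq
    exact h1.trans (mul_le_mul_of_nonneg_left h2 hk0'.le)
  -- `k C₀ N < ((k/10) log N)²` from `k > 100 C₀ N / log² N`
  have hkey : (k : ℝ) * (C₀ * N) < ((k : ℝ) * (1 / 10 * Real.log N)) ^ 2 := by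
    have h1 : 100 * C₀ * N < k * Real.log N ^ 2 := by
      have := (div_lt_iff₀ (by positivity : (0 : ℝ) < Real.log N ^ 2)).1 hk
      linarith
    nlinarith
  have hB : 0 < (k : ℝ) * (1 / 10 * Real.log N) := by positivity
  have hA : -((k : ℝ) * (1 / 10 * Real.log N)) < ∑ i ∈ Finset.Ico n (n + k), F i := by
    by_contra hcon
    have h' : (k : ℝ) * (1 / 10 * Real.log N) ≤ -∑ i ∈ Finset.Ico n (n + k), F i := by linarith [not_lt.1 hcon]
    have h'' := mul_self_le_mul_self hB.le h'
    nlinarith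
  have hpos : 0 < keiperLiCoeff (n + k) - keiperLiCoeff n := by
    rw [htel, hwin]
    linarith
  linarith

/-- **RH-FREE: window monotonicity at scale `N/log² N` (any constant) ⟹ RH.**  If for some real `C` and all large dyadic
blocks `λ_n < λ_{n+k}` whenever `N ≤ n`, `n + k ≤ 2N`, `k > C·N/log²N`, then `λ` is bounded below (strong induction:
`λ_M > λ_{⌈M/2⌉}` once `log²⌈M/2⌉ > 2|C|`), hence RH by Bombieri–Lagarias. [cite: BombieriLagarias1999, Theorem 1] -/
theorem rh_of_li_windowMonotone {C : ℝ} {N₀ : ℕ}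
    (h : ∀ N : ℕ, N₀ ≤ N → ∀ n k : ℕ, N ≤ n → n + k ≤ N + N →
      C * N / Real.log N ^ 2 < k → keiperLiCoeff n < keiperLiCoeff (n + k)) :
    _root_.RiemannHypothesis := by
  have hev : ∀ᶠ N : ℕ in atTop, 2 * |C| + 1 ≤ Real.log (N : ℝ) :=
    (Real.tendsto_log_atTop.comp tendsto_natCast_atTop_atTop).eventually_ge_atTop _
  obtain ⟨N₂, hN₂⟩ := eventually_atTop.1 hev
  obtain ⟨N₁, hN₁0, hN₁2, hN₁two⟩ : ∃ N₁ : ℕ, N₀ ≤ N₁ ∧ N₂ ≤ N₁ ∧ 2 ≤ N₁ :=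
    ⟨max N₀ (max N₂ 2), le_max_left _ _, (le_max_left _ _).trans (le_max_right _ _),
      (le_max_right _ _).trans (le_max_right _ _)⟩
  set K : ℝ := ∑ j ∈ Finset.range (N₁ + N₁), |keiperLiCoeff j| with hK
  have main : ∀ M : ℕ, -K ≤ keiperLiCoeff M := by
    intro M
    refine Nat.strong_induction_on M fun M ih ↦ ?_
    by_cases hsmall : M < N₁ + N₁
    · have hle : |keiperLiCoeff M| ≤ K :=
        Finset.single_le_sum (f := fun j ↦ |keiperLiCoeff j|) (fun j _ ↦ abs_nonneg _) (Finset.mem_range.2 hsmall)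
      linarith [neg_abs_le (keiperLiCoeff M)]
    · have hM2 : N₁ + N₁ ≤ M := not_lt.1 hsmall
      -- the midpoint `N = ⌈M/2⌉`
      set N : ℕ := (M + 1) / 2 with hNdef
      have hN₁N : N₁ ≤ N := by omega
      have hNM : N < M := by omega
      have hM2N : M ≤ N + N := by omega
      have hk : N ≤ (M - N) + 1 := by omega
      have hN2 : (2 : ℝ) ≤ N := by exact_mod_cast hN₁two.trans hN₁N
      have hN0 : (0 : ℝ) < N := by linarith
      have hlogN : 2 * |C| + 1 ≤ Real.log N := hN₂ N (hN₁2.trans hN₁N)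
      have hlog1 : 1 ≤ Real.log N := by linarith [abs_nonneg C]
      have hlogsq : 2 * |C| + 1 ≤ Real.log N ^ 2 := by nlinarith
      have hkR : (N : ℝ) ≤ ((M - N : ℕ) : ℝ) + 1 := by exact_mod_cast hk
      have hreal : C * N / Real.log N ^ 2 < ((M - N : ℕ) : ℝ) := by
        rw [div_lt_iff₀ (by positivity)]
        have h1 : (N : ℝ) / 2 ≤ ((M - N : ℕ) : ℝ) := by linarith
        have hp := mul_le_mul h1 hlogsq (by positivity) (by positivity)
        have hC : C * N ≤ |C| * N := mul_le_mul_of_nonneg_right (le_abs_self C) hN0.le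
        nlinarith
      have hstep := h N (hN₁0.trans hN₁N) N (M - N) le_rfl (by omega) hreal
      have hNM' : N + (M - N) = M := by omega
      rw [hNM'] at hstep
      have ihN := ih N hNM
      linarith
  exact riemannHypothesis_of_keiperLiCoeff_bddBelow (K := K) fun n _ ↦ main n

/-- **RH-EQUIVALENCE (RELABELLING; neither side asserted): RH ⟺ window monotonicity at scale `N/log² N`** on large
dyadic blocks, for SOME constant.  (→ `li_windowMonotone_of_rh`; ← `rh_of_li_windowMonotone`.) -/
theorem rh_iff_li_windowMonotone :
    _root_.RiemannHypothesis ↔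
      ∃ C : ℝ, ∃ N₀ : ℕ, ∀ N : ℕ, N₀ ≤ N → ∀ n k : ℕ, N ≤ n → n + k ≤ N + N →
        C * N / Real.log N ^ 2 < k → keiperLiCoeff n < keiperLiCoeff (n + k) := by
  refine ⟨fun hRH ↦ ?_, fun ⟨C, N₀, h⟩ ↦ rh_of_li_windowMonotone h⟩
  obtain ⟨C, -, N₀, h⟩ := li_windowMonotone_of_rh hRH
  exact ⟨C, N₀, h⟩

end Summit.RiemannHypothesis.RiemannHypothesis.Theorems.Splittings.LiMonotonicityScales

end
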